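import Summits.BirchSwinnertonDyer.BirchSwinnertonDyer.Theorems.PrintCFramBottomClassIndexLawFiveLeClassGroupChiTower
import Summits.BirchSwinnertonDyer.BirchSwinnertonDyer.Theorems.PrintCFramBottomClassIndexLawFiveLeHerbrandOddClassGroupDescent
import Summits.BirchSwinnertonDyer.BirchSwinnertonDyer.Theorems.PrintCFramBottomClassIndexLawFiveLeHerbrandRationalFields
import Literature.NumberTheory.GaloisRepresentations.ArtinRestriction
import Literature.NumberTheory.GaloisRepresentations.InducedGaloisRep
import HarnessLib

/-!
# Route `PrintCFram`, crux C2 `BottomClassIndexLawFiveLe` (stmt-BirchSwinnertonDyer-20372), line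
# `eisenstein-resource-bdp-line` (registry v24, arithmetic pair B1-level / B1-sha⁰): **REALISATION INDEPENDENCE OF `#e_χ(ℤ_p ⊗ Cl K)`**
# — two Galois realisations `(K₁, χ₁)`, `(K₂, χ₂)` of ONE `p`-adic character of `Γ_ℚ`, both of degree prime to `p`, have the same
# `χ`-cardinality (cell `bsd-print-cfram`, width seat `bsd-line-cfram-p1-w2` g12; helper `--supports` 20372; 0 defs, 0 facts, 0 sorry)

HONEST FRAMING. Nothing about BSD is proved here and no stub is closed. Sequel of `…ClassGroupChiTower` (the transfer ALONG A TOWER):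
here the tower is manufactured. Given two number fields `K₁`, `K₂` Galois over `ℚ` and characters `χᵢ : Gal(Kᵢ/ℚ) →* ℤ_pˣ` with the
same values on `Γ_ℚ` (`χ₁(τ̄) = χ₂(τ̄)`, bars = the tree's `absGaloisQuot`), the common core is the field `L₀ = ℚ̄^{ker φ}` cut out by
`φ = χ₁ ∘ (Γ_ℚ ↠ Gal(K₁/ℚ))`; it embeds into both `Kᵢ` (§1: an `F`-algebra map `K₀ → K` exists as soon as `res(Γ_K) ≤ res(Γ_{K₀})`,
by Krull's Galois correspondence in `ℚ̄`), `p ∤ [L₀:ℚ] ∣ [K₁:ℚ]`, and the tower transfer gives `#e_{χ₁} = #e_{χ₀} = #e_{χ₂}` (§3).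

* §1 `exists_algHom_of_range_absGaloisRestrict_le` — `res(Γ_K) ≤ res(Γ_{K₀})` ⟹ `Nonempty (K₀ →ₐ[F] K)`.
* §2 `classGroupChiCard_eq_of_range_absGaloisRestrict_le` — the tower transfer for abstract fields `K₀`, `K` so related.
* §3 **`classGroupChiCard_eq_of_absGaloisQuot_eq`** — REALISATION INDEPENDENCE (both degrees prime to `p`).
* §4 THE CENSUS READING: `forall_classGroupChiCard_eq_one_of_one` — w4 g10's hypothesis `hEreg` («EVERY abelian realisation of
  `ω ψ⁻¹` with `p ∤` degree is class-group regular», p683684) FOLLOWS from regularity at ANY ONE Galois realisation with `p ∤` degree;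
  hence **`sha_noPTorsion_of_classGroupChiCard_eq_one_at`** (EVEN-REGULAR at one realisation ⟹ `Ш(W)[p] = 0`, mod CT + GZK) and
  **`classGroupChiCard_ne_one_at_of_sha_ne_zero`** (`Ш(W)[p] ≠ 0` ⟹ EVERY such realisation is irregular) — so the B1-sha⁰ census of
  w2 g11 / w4 g10 / w7 g4–g5 reads at ONE field of the reader's choice (e.g. the CM reflection field `K′` of p687909 §3, or the real
  cyclic field `ℚ̄^{ker θ_e}` of degree dividing `p − 1`).

THEOREMS ONLY; no definition, no named fact, no `sorry`. BSD is not proved by any of this; no summit statement is proved by this seat.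
References: [NeukirchANT1999] Ch. IV §1 (Krull correspondence); [Lang1990] Ch. 13 §3 Lemma 1; [Washington1997] §10.2.
-/

set_option autoImplicit false
-- `…BirchSwinnertonDyer.BirchSwinnertonDyer.Theorems…` is the problem's mandated namespace (D-0017).
set_option linter.dupNamespace false

noncomputable section

open scoped TensorProduct

namespace Summit.BirchSwinnertonDyer.BirchSwinnertonDyer.Theorems.PrintCFram.ClassGroupChiTower

open Field NumberField Literature.NumberTheory.NumberFields Literature.NumberTheory.GaloisRepresentations
open Summit.BirchSwinnertonDyer.BirchSwinnertonDyer.Theorems.PrintCFram.HerbrandSelmerToHom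
open Summit.BirchSwinnertonDyer.BirchSwinnertonDyer.Theorems.PrintCFram.HerbrandOddClassGroup

/-! ## §1 An embedding `K₀ → K` from `res(Γ_K) ≤ res(Γ_{K₀})` -/

/-- **Krull's correspondence, embedding form.** For algebraic extensions `K₀`, `K` of a field `F` of characteristic `0`: if the image
of `Γ_K` in `Γ_F` lies in the image of `Γ_{K₀}` (for the tree's chosen restrictions `absGaloisRestrict`), then the chosen copy
`absEmbedding F K₀ (K₀) ⊆ F̄` lies in `absEmbedding F K (K)` (both copies are the fixed fields of those images), whence an `F`-algebra
map `K₀ → K`. [cite: NeukirchANT1999, Ch. IV §1 (Thm. (1.2), Krull)] -/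
theorem exists_algHom_of_range_absGaloisRestrict_le (F K₀ K : Type) [Field F] [CharZero F] [Field K₀] [Field K] [Algebra F K₀]
    [Algebra F K] [Algebra.IsAlgebraic F K₀] [Algebra.IsAlgebraic F K]
    (hle : (absGaloisRestrict F K).range ≤ (absGaloisRestrict F K₀).range) : Nonempty (K₀ →ₐ[F] K) := by
  haveI : IsGalois F (AlgebraicClosure F) := IsAlgClosure.isGalois F (AlgebraicClosure F)
  -- every `absEmbedding F K₀ x` is fixed by the fixing subgroup of the copy `E` of `K`, which is `res(Γ_K) ≤ res(Γ_{K₀})`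
  set E : IntermediateField F (AlgebraicClosure F) := (absEmbedding F K).fieldRange with hE
  have hmem : ∀ x : K₀, absEmbedding F K₀ x ∈ E := fun x => by
    rw [← InfiniteGalois.fixedField_fixingSubgroup E, IntermediateField.mem_fixedField_iff]
    intro g hg
    rw [IntermediateField.mem_fixingSubgroup_iff] at hg
    -- `g`, read in `Γ_F`, fixes the copy of `K` pointwise, hence lies in `res(Γ_K) ≤ res(Γ_{K₀})`
    have hg' : (absoluteGaloisGroup.toAlgEquiv F).symm g ∈ (absGaloisRestrict F K).range :=
      (mem_range_absGaloisRestrict_iff_smul_absEmbedding F K _).mpr fun y => by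
        rw [absoluteGaloisGroup.toAlgEquiv_symm_apply]
        exact hg _ (AlgHom.mem_fieldRange.mpr ⟨y, rfl⟩)
    have h := (mem_range_absGaloisRestrict_iff_smul_absEmbedding F K₀ _).mp (hle hg') x
    rwa [absoluteGaloisGroup.toAlgEquiv_symm_apply] at h
  -- `K₀ → E ≅ K`
  have hrange : ∀ x : K₀, absEmbedding F K₀ x ∈ (absEmbedding F K).range := fun x => by
    obtain ⟨y, hy⟩ := (AlgHom.mem_fieldRange.mp (hmem x))
    exact ⟨y, hy⟩
  exact ⟨((AlgEquiv.ofInjectiveField (absEmbedding F K)).symm : (absEmbedding F K).range →ₐ[F] K).comp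
    ((absEmbedding F K₀).codRestrict (absEmbedding F K).range hrange)⟩

/-- The fixed field `F̄^N` of an open NORMAL subgroup `N ≤ Γ_F` (characteristic `0`) is a finite Galois extension of `F` with
`res(Γ_{F̄^N}) = N` and `[F̄^N : F] = [Γ_F : N]` (Krull; the tree's `finiteDimensional_fixedField_of_isOpen`,
`range_absGaloisRestrict_fixedField_eq_of_normal`, `finrank_fixedField_of_isOpen`, Mathlib `IsGalois.of_fixedField_normal_subgroup`,
packaged for a general base field so that no second `ℚ`-algebra structure on `ℚ̄` is ever synthesised).
[cite: NeukirchANT1999, Ch. IV §1 (Thm. (1.2), Krull)] -/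
theorem isGalois_fixedField_of_isOpen_normal (F : Type) [Field F] [CharZero F] (N : Subgroup (absoluteGaloisGroup F)) [hn : N.Normal]
    (hN : IsOpen (N : Set (absoluteGaloisGroup F))) :
    FiniteDimensional F (IntermediateField.fixedField N : IntermediateField F (AlgebraicClosure F)) ∧
      IsGalois F (IntermediateField.fixedField N : IntermediateField F (AlgebraicClosure F)) ∧
      (absGaloisRestrict F (IntermediateField.fixedField N : IntermediateField F (AlgebraicClosure F))).range = N ∧
      Module.finrank F (IntermediateField.fixedField N : IntermediateField F (AlgebraicClosure F)) = N.index := by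
  haveI : FiniteDimensional F (IntermediateField.fixedField N : IntermediateField F (AlgebraicClosure F)) :=
    finiteDimensional_fixedField_of_isOpen N hN
  haveI : IsGalois F (AlgebraicClosure F) := IsAlgClosure.isGalois F (AlgebraicClosure F)
  exact ⟨inferInstance, IsGalois.of_fixedField_normal_subgroup (hn := hn) N,
    range_absGaloisRestrict_fixedField_eq_of_normal (K := F) N hN, finrank_fixedField_of_isOpen N hN⟩

/-! ## §2 The tower transfer for abstract fields related by `res(Γ_K) ≤ res(Γ_{K₀})` -/

variable (p : ℕ) [Fact p.Prime]

/-- **Transfer between abstract realisations.** `K₀`, `K` number fields Galois over `ℚ` with `res(Γ_K) ≤ res(Γ_{K₀})` («`K₀ ⊆ K`»),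
`p ∤ [K:ℚ]`, characters `χ₀`, `χ` of `Gal(K₀/ℚ)`, `Gal(K/ℚ)` into `ℤ_pˣ` with the same values on `Γ_ℚ`: `#e_χ(ℤ_p ⊗ Cl K) = #e_{χ₀}(ℤ_p ⊗ Cl K₀)`
(embed by §1, then `classGroupChiCard_eq_of_tower_of_absGaloisQuot`). [cite: Lang1990, Ch. 13 §3 Lemma 1 (PDF p. 201)]
[cite: NeukirchANT1999, Ch. IV §1] -/
theorem classGroupChiCard_eq_of_range_absGaloisRestrict_le (K₀ K : Type) [Field K₀] [NumberField K₀] [Field K] [NumberField K]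
    [IsGalois ℚ K₀] [IsGalois ℚ K] (hle : (absGaloisRestrict ℚ K).range ≤ (absGaloisRestrict ℚ K₀).range)
    (hpK : ¬ p ∣ Module.finrank ℚ K) (χ₀ : (K₀ ≃ₐ[ℚ] K₀) →* ℤ_[p]ˣ) (χ : (K ≃ₐ[ℚ] K) →* ℤ_[p]ˣ)
    (h : ∀ τ : absoluteGaloisGroup ℚ, χ (absGaloisQuot ℚ K τ) = χ₀ (absGaloisQuot ℚ K₀ τ)) :
    classGroupChiCard ℚ K p (fun g => ((χ g : ℤ_[p]ˣ) : ℤ_[p])) = classGroupChiCard ℚ K₀ p (fun s => ((χ₀ s : ℤ_[p]ˣ) : ℤ_[p])) := by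
  haveI : Algebra.IsAlgebraic ℚ K₀ := Algebra.IsAlgebraic.of_finite ℚ K₀
  haveI : Algebra.IsAlgebraic ℚ K := Algebra.IsAlgebraic.of_finite ℚ K
  obtain ⟨φ⟩ := exists_algHom_of_range_absGaloisRestrict_le ℚ K₀ K hle
  letI : Algebra K₀ K := φ.toRingHom.toAlgebra
  haveI : IsScalarTower ℚ K₀ K := IsScalarTower.of_algebraMap_eq fun x => (φ.commutes x).symm
  exact classGroupChiCard_eq_of_tower_of_absGaloisQuot ℚ K₀ K p hpK χ₀ χ h

/-! ## §3 Realisation independence -/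

/-- **REALISATION INDEPENDENCE of `#e_χ(ℤ_p ⊗ Cl)`.** Let `K₁`, `K₂` be number fields Galois over `ℚ` with `p ∤ [K₁:ℚ]`, `p ∤ [K₂:ℚ]`,
and `χᵢ : Gal(Kᵢ/ℚ) →* ℤ_pˣ` two characters with the same values on `Γ_ℚ` (`χ₁(τ̄) = χ₂(τ̄)` for all `τ`). Then
`#e_{χ₁}(ℤ_p ⊗ Cl K₁) = #e_{χ₂}(ℤ_p ⊗ Cl K₂)`. PROOF: the common character `φ = χ₁ ∘ (Γ_ℚ ↠ Gal(K₁/ℚ))` has open normal kernel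
`N ⊇ res(Γ_{K₁})`; its fixed field `L₀ = ℚ̄^N` is a number field Galois over `ℚ` with `res(Γ_{L₀}) = N` and `[L₀:ℚ] = [Γ_ℚ:N] ∣ [K₁:ℚ]`
(so `p ∤ [L₀:ℚ]`), `φ` descends to `χ₀` on `Gal(L₀/ℚ)`, and `res(Γ_{Kᵢ}) ≤ N` for BOTH `i` (for `i = 2` through the equality of values);
§2 twice. [cite: Lang1990, Ch. 13 §3 Lemma 1 (PDF p. 201)] [cite: NeukirchANT1999, Ch. IV §1] [cite: Washington1997, §10.2] -/
theorem classGroupChiCard_eq_of_absGaloisQuot_eq (K₁ K₂ : Type) [Field K₁] [NumberField K₁] [Field K₂] [NumberField K₂]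
    [IsGalois ℚ K₁] [IsGalois ℚ K₂] (hp₁ : ¬ p ∣ Module.finrank ℚ K₁) (hp₂ : ¬ p ∣ Module.finrank ℚ K₂)
    (χ₁ : (K₁ ≃ₐ[ℚ] K₁) →* ℤ_[p]ˣ) (χ₂ : (K₂ ≃ₐ[ℚ] K₂) →* ℤ_[p]ˣ)
    (h : ∀ τ : absoluteGaloisGroup ℚ, χ₁ (absGaloisQuot ℚ K₁ τ) = χ₂ (absGaloisQuot ℚ K₂ τ)) :
    classGroupChiCard ℚ K₁ p (fun g => ((χ₁ g : ℤ_[p]ˣ) : ℤ_[p])) = classGroupChiCard ℚ K₂ p (fun g => ((χ₂ g : ℤ_[p]ˣ) : ℤ_[p])) := by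
  classical
  -- the common character of `Γ_ℚ` and its kernel
  set φ : absoluteGaloisGroup ℚ →* ℤ_[p]ˣ := χ₁.comp (absGaloisQuot ℚ K₁) with hφ
  set N : Subgroup (absoluteGaloisGroup ℚ) := φ.ker with hN
  haveI hNn : N.Normal := MonoidHom.normal_ker φ
  have hK₁N : (absGaloisRestrict ℚ K₁).range ≤ N := by
    rintro _ ⟨σ, rfl⟩
    rw [hN, MonoidHom.mem_ker, hφ, MonoidHom.comp_apply]
    change χ₁ (absGaloisQuot ℚ K₁ (absGaloisRestrict ℚ K₁ σ)) = 1
    rw [absGaloisQuot_absGaloisRestrict, map_one]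
  have hK₂N : (absGaloisRestrict ℚ K₂).range ≤ N := by
    rintro _ ⟨σ, rfl⟩
    rw [hN, MonoidHom.mem_ker, hφ, MonoidHom.comp_apply]
    change χ₁ (absGaloisQuot ℚ K₁ (absGaloisRestrict ℚ K₂ σ)) = 1
    rw [h, absGaloisQuot_absGaloisRestrict, map_one]
  have hNopen : IsOpen (N : Set (absoluteGaloisGroup ℚ)) :=
    Subgroup.isOpen_mono hK₁N (isOpen_range_absGaloisRestrict ℚ K₁)
  -- `[Γ_ℚ : N] ∣ [K₁ : ℚ]`, so `p ∤ [Γ_ℚ : N]`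
  have hidx : ¬ p ∣ N.index := by
    intro hdvd
    have h1 : N.index ∣ (absGaloisQuot ℚ K₁).ker.index :=
      Subgroup.index_dvd_of_le fun τ hτ => by
        rw [MonoidHom.mem_ker] at hτ
        rw [hN, MonoidHom.mem_ker, hφ, MonoidHom.comp_apply, hτ, map_one]
    have h2 : (absGaloisQuot ℚ K₁).ker.index = Nat.card (K₁ ≃ₐ[ℚ] K₁) := by
      rw [Subgroup.index_ker, MonoidHom.range_eq_top.mpr (absGaloisQuot_surjective ℚ K₁), Subgroup.card_top]
    rw [h2, IsGalois.card_aut_eq_finrank] at h1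
    exact hp₁ (hdvd.trans h1)
  -- the core field `L₀ = ℚ̄^N` (as a TYPE with its canonical `ℚ`-algebra structure)
  set L₀ : IntermediateField ℚ (AlgebraicClosure ℚ) := IntermediateField.fixedField N with hL₀
  obtain ⟨hfd, hGal, hrange, hfinrank⟩ :
      FiniteDimensional ℚ L₀ ∧ IsGalois ℚ L₀ ∧ (absGaloisRestrict ℚ L₀).range = N ∧ Module.finrank ℚ L₀ = N.index :=
    isGalois_fixedField_of_isOpen_normal ℚ N hNopen
  have hfin : ¬ p ∣ Module.finrank ℚ L₀ := by rw [hfinrank]; exact hidx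
  -- the two `ℚ`-algebra structures on the type `L₀` coincide
  have eL : (DivisionRing.toRatAlgebra : Algebra ℚ L₀) = L₀.algebra := Subsingleton.elim _ _
  haveI hLnf : NumberField L₀ :=
    { to_charZero := inferInstance, to_finiteDimensional := by rw [eL]; exact hfd }
  haveI hGal' : @IsGalois ℚ _ (L₀ : Type) _ DivisionRing.toRatAlgebra := by rw [eL]; exact hGal
  have hrange' : (@absGaloisRestrict ℚ (L₀ : Type) _ _ DivisionRing.toRatAlgebra).range = N := by rw [eL]; exact hrange
  have hfin' : ¬ p ∣ @Module.finrank ℚ (L₀ : Type) _ _ (@Algebra.toModule _ _ _ _ DivisionRing.toRatAlgebra) := by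
    rw [eL]; exact hfin
  -- descend `φ` to `Gal(L₀/ℚ)` (for the canonical `ℚ`-algebra structure)
  have hφL : ∀ σ : absoluteGaloisGroup L₀, φ (@absGaloisRestrict ℚ (L₀ : Type) _ _ DivisionRing.toRatAlgebra σ) = 1 :=
    fun σ => by
    have hσ : @absGaloisRestrict ℚ (L₀ : Type) _ _ DivisionRing.toRatAlgebra σ ∈ N := hrange' ▸ ⟨σ, rfl⟩
    exact hσ
  obtain ⟨χ₀, hχ₀⟩ :=
    @exists_factor_absGaloisQuot ℚ (L₀ : Type) _ _ DivisionRing.toRatAlgebra IsGalois.to_normal ℤ_[p]ˣ _ φ hφL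
  -- §2 twice
  have hle₁ : (absGaloisRestrict ℚ K₁).range ≤ (@absGaloisRestrict ℚ (L₀ : Type) _ _ DivisionRing.toRatAlgebra).range :=
    hrange'.symm ▸ hK₁N
  have hle₂ : (absGaloisRestrict ℚ K₂).range ≤ (@absGaloisRestrict ℚ (L₀ : Type) _ _ DivisionRing.toRatAlgebra).range :=
    hrange'.symm ▸ hK₂N
  have e₁ := classGroupChiCard_eq_of_range_absGaloisRestrict_le p L₀ K₁ hle₁ hp₁ χ₀ χ₁ fun τ => by
    rw [hχ₀ τ]; rfl
  have e₂ := classGroupChiCard_eq_of_range_absGaloisRestrict_le p L₀ K₂ hle₂ hp₂ χ₀ χ₂ fun τ => by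
    rw [hχ₀ τ, ← h τ]; rfl
  rw [e₁, e₂]

end Summit.BirchSwinnertonDyer.BirchSwinnertonDyer.Theorems.PrintCFram.ClassGroupChiTower

end
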